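import Summits.QuantumFields.BalabanUV.Beta.GAN24.DirichletExhaustionDecays
import Summits.QuantumFields.BalabanUV.Beta.GAN24.DirichletExhaustionCovariance
import Summits.QuantumFields.BalabanUV.Beta.GAN24.CombesThomas

/-!
# `BalabanUV.Beta.GAN24.DirichletExhaustionWall` — binder row G-an2-4 / (CONV-C), part P2, PART 6: ROAD P2 LANDS IN THE WALL'S
# BINDER CURRENCIES — `ConvC` (PART 1) ⟹ road P1's `UniformDecays` / `SupRate` / `DecayCauchy` (`GAN24/CombesThomas`, gan24-p1)
# with NO halving of the rate and NO square root of the ratio (unit b2b-balaban-gan24-p2, gen 1, v1)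

HONEST FRAMING (cell contract, verbatim): «discharging `BetaPertH` makes Bałaban's UV stability UNCONDITIONAL — a real
constructive-QFT result; it is NOT the continuum limit and NOT the Clay problem.»  The propagator binders of the β wall's END
(`HessKerDressedUnitsWall.d1Drift_JsBalOf_iff_of_cauchy_unit`, read by gan24-p1 as (hK) `UniformDecays K C δ` and (hKall)
`DecayCauchy K cK θ δ` over `K : ℕ → MKer D F`) are reached here from PART 1's target shape `ConvC` by bookkeeping only: the uniform
clause IS (hK) (rate `δ₄/d` in the β-lane's ℓ¹ distance, PART 4), and the step clause — already stated in the exponentially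
WEIGHTED norm — telescopes to (hKall) with constant `C₄/(1−θ)` and the SAME `(θ, δ₄/d)` (road P1's `decayCauchy_of_stepDecay` BY NAME),
whereas road P1's own reduction from a SUP-norm rate costs `(θ, δ) ↦ (√θ, δ/2)` (`decayCauchy_of_uniformDecays_supRate`).  Applied to
PART 2's Dirichlet inverse families and PART 5's (2.156)-shaped covariance families: (hK)+(hKall) for them from `OpFamilyRate` /
`CovInput`, explicit constants.  Nothing here identifies the wall's `KInvStep Lc j` with such a family (that dictionary is the open
item (R)/(I1) of GAPS rows G-an2-4 / G-gan24p2-1); nothing of Bałaban's is instantiated; NOT `BetaPertH`, NOT continuum, NOT Clay.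
«not in print; our proof attempt».

ABSOLUTE RULE (cell, verbatim): «No internally-minted statement may enter as a cited fact. Every hypothesis is either
kernel-proved in this package or a verbatim quotation of a PUBLISHED theorem with page reference. The manuscript(s) under
audit are NOT citable for their own disputed steps — they are the thing under adjudication; programme-internal
(2001/route/tribunal) claims are never citable.»

## What this file proves (0 sorry; imports PARTS 4, 5 and gan24-p1's `GAN24/CombesThomas`)
`uniformDecays_of_convC`, `supRate_of_convC`, **`decayCauchy_of_convC`** (`ConvC C C₄ δ₄ θ`, `0 ≤ θ < 1` ⟹
`DecayCauchy (k ↦ toMKer (C k)) (C₄/(1−θ)) θ (δ₄/d)`); for the families: **`decayCauchy_limInv`** / `uniformDecays_limInv`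
(PART 2's `convC_limInv`), **`decayCauchy_cov`** / `uniformDecays_cov` (PART 5's `convC_cov`).  NOT summit progress.
-/

namespace Summit.QuantumFields.BalabanUV.Beta.GAN24.DirichletExhaustionWall

open Finset Real Filter Topology
open Literature.MathematicalPhysics.QuantumFieldTheory.Balaban1983to89
open Literature.MathematicalPhysics.QuantumFieldTheory.Balaban1983to89.Beta
open B12Sec2to5 (l1 l1_nonneg)
open ExpKernelCalculus (MKer Decays)
open B4Sect5Proof (cStar deltaStar cStar_pos deltaStar_pos)
open B4Sect5Exhaustion (K Hyp56Z limInv)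
open Summit.QuantumFields.BalabanUV.Beta.GAN24.DirichletExhaustion
open Summit.QuantumFields.BalabanUV.Beta.GAN24.DirichletExhaustionFamily
open Summit.QuantumFields.BalabanUV.Beta.GAN24.DirichletExhaustionSandwich
open Summit.QuantumFields.BalabanUV.Beta.GAN24.DirichletExhaustionDecays
open Summit.QuantumFields.BalabanUV.Beta.GAN24.DirichletExhaustionCovariance
open Summit.QuantumFields.BalabanUV.Beta.GAN24.CombesThomas (SupBound UniformDecays SupRate DecayCauchy
  decayCauchy_of_stepDecay)

noncomputable section

variable {d N : ℕ}

/-! ## §1 `ConvC` ⟹ road P1's currencies -/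

section Generic

variable {C : ℕ → K d N → K d N → ℝ} {C₄ δ₄ θ : ℝ}

/-- The uniform clause of `ConvC` IS the wall's (hK) `UniformDecays` (ℓ¹ rate `δ₄/d`). -/
theorem uniformDecays_of_convC (hC₄ : 0 ≤ C₄) (hδ₄ : 0 ≤ δ₄) (h : ConvC C C₄ δ₄ θ) :
    UniformDecays (fun k => toMKer (C k)) C₄ (δ₄ / d) :=
  fun k => decays_of_convC hC₄ hδ₄ h k

/-- The step clause of `ConvC` implies road P1's SUP-norm one-step rate `SupRate … C₄ θ` (drop the weight). -/
theorem supRate_of_convC (hC₄ : 0 ≤ C₄) (hδ₄ : 0 ≤ δ₄) (hθ : 0 ≤ θ) (h : ConvC C C₄ δ₄ θ) :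
    SupRate (fun k => toMKer (C k)) C₄ θ := by
  intro j x y a b
  have h1 := decays_sub_of_convC hC₄ hδ₄ hθ h j x y a b
  refine h1.trans (mul_le_of_le_one_right (by positivity) ?_)
  exact Real.exp_le_one_iff.2 (by
    have := l1_nonneg (x - y)
    have : 0 ≤ δ₄ / d := div_nonneg hδ₄ (Nat.cast_nonneg d)
    nlinarith)

/-- **`ConvC` ⟹ the wall's (hKall) `DecayCauchy` with the SAME ratio `θ` and rate `δ₄/d`** (constant `C₄/(1−θ)`): the step clause is
already in the weighted norm, so road P1's telescoping `decayCauchy_of_stepDecay` applies verbatim — no `(√θ, δ/2)` loss. -/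
theorem decayCauchy_of_convC (hC₄ : 0 ≤ C₄) (hδ₄ : 0 ≤ δ₄) (hθ0 : 0 ≤ θ) (hθ1 : θ < 1) (h : ConvC C C₄ δ₄ θ) :
    DecayCauchy (fun k => toMKer (C k)) (C₄ / (1 - θ)) θ (δ₄ / d) :=
  decayCauchy_of_stepDecay (K := fun k => toMKer (C k)) (fun j => decays_sub_of_convC hC₄ hδ₄ hθ0 h j) hC₄ hθ0 hθ1

end Generic

/-! ## §2 The Dirichlet inverse families (PART 2) in the wall's currencies -/

section Family

variable {Ω : Set (Fin d → ℤ)} {A : ℕ → K d N → K d N → ℝ} {γ₀ c₀ δ₀ θ₀ θ : ℝ}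

/-- (hK) for `k ↦ (A_k)_Λ⁻¹`: `UniformDecays (k ↦ toMKer (limInv Λ (A k))) (max{c⋆, rateConst·θ₀}) (δ⋆/d)`. -/
theorem uniformDecays_limInv (hγ : 0 < γ₀) (hc : 0 < c₀) (hδ : 0 < δ₀) (hθ₀ : 0 ≤ θ₀) (hθ : 0 ≤ θ)
    (hF : OpFamilyRate Ω A γ₀ c₀ δ₀ θ₀ θ) {Λ : Set (Fin d → ℤ)} (hΛ : Λ ⊆ Ω) :
    UniformDecays (fun k => toMKer (limInv Λ (A k))) (convConst d N γ₀ c₀ δ₀ θ₀) (deltaStar d N γ₀ c₀ δ₀ / d) :=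
  uniformDecays_of_convC ((cStar_pos d N c₀ δ₀ hγ).le.trans (le_max_left _ _)) (deltaStar_pos d N hγ hc.le hδ).le
    (convC_limInv hγ hc hδ hθ₀ hθ hF hΛ)

/-- **(hKall) for `k ↦ (A_k)_Λ⁻¹`** from `OpFamilyRate` (`0 ≤ θ < 1`):
`DecayCauchy (k ↦ toMKer (limInv Λ (A k))) (max{c⋆, rateConst·θ₀}/(1−θ)) θ (δ⋆/d)`, every `Λ ⊆ Ω`. -/
theorem decayCauchy_limInv (hγ : 0 < γ₀) (hc : 0 < c₀) (hδ : 0 < δ₀) (hθ₀ : 0 ≤ θ₀) (hθ : 0 ≤ θ) (hθ1 : θ < 1)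
    (hF : OpFamilyRate Ω A γ₀ c₀ δ₀ θ₀ θ) {Λ : Set (Fin d → ℤ)} (hΛ : Λ ⊆ Ω) :
    DecayCauchy (fun k => toMKer (limInv Λ (A k))) (convConst d N γ₀ c₀ δ₀ θ₀ / (1 - θ)) θ
      (deltaStar d N γ₀ c₀ δ₀ / d) :=
  decayCauchy_of_convC ((cStar_pos d N c₀ δ₀ hγ).le.trans (le_max_left _ _)) (deltaStar_pos d N hγ hc.le hδ).le hθ hθ1
    (convC_limInv hγ hc hδ hθ₀ hθ hF hΛ)

end Family

/-! ## §3 The (2.156)-shaped covariance families (PART 5) in the wall's currencies -/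

section Cov

variable {Ω : Set (Fin d → ℤ)} {C : K d N → K d N → ℝ} {Δ : ℕ → K d N → K d N → ℝ} {cC c₀ δ γ θ₀ θ : ℝ}

/-- The (CONV-C) constant of PART 5's socket, abbreviated. -/
def covConst (d N : ℕ) (cC c₀ δ γ θ₀ : ℝ) : ℝ :=
  sandwichConst d N cC (deltaStar d N γ (sandwichConst d N cC δ * c₀) (δ / 2)) *
    convConst d N γ (sandwichConst d N cC δ * c₀) (δ / 2) (sandwichConst d N cC δ * θ₀)

/-- The (CONV-C) rate of PART 5's socket, abbreviated: `δ⋆/2`. -/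
def covRate (d N : ℕ) (cC c₀ δ γ : ℝ) : ℝ := deltaStar d N γ (sandwichConst d N cC δ * c₀) (δ / 2) / 2

/-- `covConst ≥ 0`. -/
theorem covConst_nonneg (hδ : 0 < δ) (hN : 0 < N) (hcC : 0 < cC) (hc₀ : 0 < c₀) (hγ : 0 < γ) :
    0 ≤ covConst d N cC c₀ δ γ θ₀ := by
  unfold covConst
  have hs := sandwichConst_pos d hN hcC hδ
  have hδs : 0 < deltaStar d N γ (sandwichConst d N cC δ * c₀) (δ / 2) :=
    deltaStar_pos d N hγ (by positivity) (half_pos hδ)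
  have h1 := sandwichConst_nonneg d N cC hδs
  have h2 : 0 ≤ convConst d N γ (sandwichConst d N cC δ * c₀) (δ / 2) (sandwichConst d N cC δ * θ₀) :=
    (cStar_pos d N _ _ hγ).le.trans (le_max_left _ _)
  positivity

/-- `covRate > 0`. -/
theorem covRate_pos (hδ : 0 < δ) (hN : 0 < N) (hcC : 0 < cC) (hc₀ : 0 < c₀) (hγ : 0 < γ) : 0 < covRate d N cC c₀ δ γ := by
  unfold covRate
  have hs := sandwichConst_pos d hN hcC hδ
  have := deltaStar_pos d N hγ (show 0 ≤ sandwichConst d N cC δ * c₀ by positivity) (half_pos hδ)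
  positivity

/-- PART 5's END theorem in the abbreviations: `ConvC (cov C Δ Λ) covConst covRate θ`. -/
theorem convC_cov' (h : CovInput Ω C Δ cC c₀ δ γ θ₀ θ) (hδ : 0 < δ) (hN : 0 < N) (hcC : 0 < cC) (hc₀ : 0 < c₀)
    (hγ : 0 < γ) (hθ₀ : 0 ≤ θ₀) (hθ : 0 ≤ θ) {Λ : Set (Fin d → ℤ)} (hΛ : Λ ⊆ Ω) :
    ConvC (cov C Δ Λ) (covConst d N cC c₀ δ γ θ₀) (covRate d N cC c₀ δ γ) θ :=
  convC_cov h hδ hN hcC hc₀ hγ hθ₀ hθ hΛ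

/-- (hK) for the covariance family: `UniformDecays (k ↦ toMKer (cov C Δ Λ k)) covConst (covRate/d)`. -/
theorem uniformDecays_cov (h : CovInput Ω C Δ cC c₀ δ γ θ₀ θ) (hδ : 0 < δ) (hN : 0 < N) (hcC : 0 < cC) (hc₀ : 0 < c₀)
    (hγ : 0 < γ) (hθ₀ : 0 ≤ θ₀) (hθ : 0 ≤ θ) {Λ : Set (Fin d → ℤ)} (hΛ : Λ ⊆ Ω) :
    UniformDecays (fun k => toMKer (cov C Δ Λ k)) (covConst d N cC c₀ δ γ θ₀) (covRate d N cC c₀ δ γ / d) :=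
  uniformDecays_of_convC (covConst_nonneg hδ hN hcC hc₀ hγ) (covRate_pos hδ hN hcC hc₀ hγ).le
    (convC_cov' h hδ hN hcC hc₀ hγ hθ₀ hθ hΛ)

/-- **(hKall) for the (2.156)-shaped covariance family** from the five inputs (`0 ≤ θ < 1`):
`DecayCauchy (k ↦ toMKer (C·(CᵀΔ_kC)_Λ⁻¹·Cᵀ)) (covConst/(1−θ)) θ (covRate/d)` on every `Λ ⊆ Ω` — the wall's propagator binder SHAPE
for a covariance-type constituent, with the supplier's `θ` unchanged and all other constants displayed. -/
theorem decayCauchy_cov (h : CovInput Ω C Δ cC c₀ δ γ θ₀ θ) (hδ : 0 < δ) (hN : 0 < N) (hcC : 0 < cC) (hc₀ : 0 < c₀)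
    (hγ : 0 < γ) (hθ₀ : 0 ≤ θ₀) (hθ : 0 ≤ θ) (hθ1 : θ < 1) {Λ : Set (Fin d → ℤ)} (hΛ : Λ ⊆ Ω) :
    DecayCauchy (fun k => toMKer (cov C Δ Λ k)) (covConst d N cC c₀ δ γ θ₀ / (1 - θ)) θ
      (covRate d N cC c₀ δ γ / d) :=
  decayCauchy_of_convC (covConst_nonneg hδ hN hcC hc₀ hγ) (covRate_pos hδ hN hcC hc₀ hγ).le hθ hθ1
    (convC_cov' h hδ hN hcC hc₀ hγ hθ₀ hθ hΛ)

end Cov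

end

end Summit.QuantumFields.BalabanUV.Beta.GAN24.DirichletExhaustionWall
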